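import Mathlib
import HarnessLib
import Literature.NumberTheory.LFunctions.RHInvZetaBound
import Summits.Parity.BatemanHorn.Theses.AlmostPrimeZeros
import Summits.Parity.BatemanHorn.Theorems.AlmostPrimeZerosDeficitFromRepulsion
import Summits.Parity.BatemanHorn.Theorems.AlmostPrimeZerosSystemMomentDeficitZeroFree
import Summits.Parity.BatemanHorn.Theorems.AlmostPrimeZerosSystemMomentDeficitPoissonJensenBound
import Summits.Parity.BatemanHorn.Theorems.AlmostPrimeZerosSystemMomentDeficitLogDerivPolynomial
import Summits.Parity.BatemanHorn.Theorems.AlmostPrimeZerosSystemMomentDeficitSmallCircleOfDiscMajorantLog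
import Summits.Parity.BatemanHorn.Theorems.AlmostPrimeZerosSystemMomentDeficitSmallCircleOfZeroRepulsion
import Summits.Parity.BatemanHorn.Theorems.AlmostPrimeZerosSystemMomentDeficitSmallCircleJensenX

/-!
# Crux `SystemMomentDeficit` (stmt-Parity-11326): the small-circle mean pinches the vertical line
# (`SmallCircleJensen → VerticalSubGaussian`)

Route `AlmostPrimeZeros`, crux
`Summit.Parity.BatemanHorn.Theses.AlmostPrimeZeros.SystemMomentDeficit` (rank 4), line `Sketch`
(idea `small-circle-jensen`), lead c6.  Everything here is sorry-free and definition-free.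

Lead c6 reshaped the line's registered stub from K1 = `stub_smallCircleJensen` (an angular-L¹
bound for `log⁺‖S_x(z)e^{−a(z−1)}/(x+1)‖` on one circle `‖z−1‖ = r`) to the weaker, tilt-free
VSG = `stub_verticalSubGaussian` (a PINCHED bound `‖S_x(1+iy)‖ ≤ (x+1)e^{Cy²}` on a vertical
segment `0 < y ≤ y₀`), which gives the crux by a second-derivative test
(`systemMomentDeficit_of_verticalSubGaussian`, `…VerticalLine.lean`, p163855).  This file proves
that the old stub implies the new one, so that nothing of the line's in-tree DAG is lost:

* `norm_vertical_le_exp_of_zeroFree` — **pinching lemma** (complex analysis): if `F` is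
  holomorphic and zero-free on `‖z − 1‖ < R`, `F(1) = 1`, `‖F‖ ≤ e^M` there (`M ≥ 0`) and `F'(1)` is
  REAL, then `‖F(1+iy)‖ ≤ exp(64(M+1)y²/R²)` for `|y| ≤ R/4`.  Proof: holomorphic logarithm `L`,
  `L(1) = 0`, `Re L ≤ M` (`Literature…InvZetaRH.exists_log_of_ball`); Borel–Carathéodory
  (`Complex.borelCaratheodory_zero`) gives `‖L‖ ≤ 2(M+1)` on `‖z−1‖ ≤ R/2`; Cauchy's estimate on
  circles of radius `R/4` centred on the segment gives `‖L''‖ ≤ 64(M+1)/R²` there; along the segment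
  `g(y) = Re L(1+iy)` has `g(0) = 0` and `g'(0) = −Im L'(1) = −Im F'(1) = 0`, so two applications of
  the mean value inequality give `g(y) ≤ 64(M+1)y²/R²`, and `‖F(1+iy)‖ = e^{g(y)}`.
* `verticalBound_of_circleAverage` — **per statistic**: for `S(z) = Σ_{n ≤ x} z^{e n}` and any real
  tilt `a`, `⨍_{‖z−1‖=r} log⁺‖S(z)e^{−a(z−1)}/(x+1)‖ ≤ A` implies
  `‖S(1+iy)‖ ≤ (x+1)·exp(256(3A+1)e^{2A} y²/r²)` for `|y| ≤ r e^{−A}/8` (the landed Jensen zero-free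
  disc `stub_zeroFree` and Poisson–Jensen bound `stub_poissonJensenBound` feed the pinching lemma with
  `R = r e^{−A}/2`, `M = 3A`; `F'(1) = Σe/(x+1) − a` is real; on the vertical line the tilt has
  modulus `1`).
* `verticalSubGaussian_of_smallCircle` (registered sub-goal) — **K1-shape ⇒ VSG-shape** for every
  Bateman–Horn system; with the landed edges this gives `verticalSubGaussian_of_discMajorantLog`
  (rank 8 ⇒ VSG), `verticalSubGaussian_of_systemZeroRepulsion` (rank 2 ⇒ VSG) and the calibration
  `verticalSubGaussian_X` (VSG holds for the system `(X)`).

So in the tree: rank 8 ⇒ K1 ⇒ VSG ⇒ rank 4, rank 2 ⇒ K1, VSG at `(X)`; the line `Sketch` is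
`SystemMomentDeficit_of := systemMomentDeficit_of_verticalSubGaussian stub_verticalSubGaussian`.

References: E. C. Titchmarsh, *The Theory of Functions*, 2nd ed., §5.5 (Borel–Carathéodory),
§2.5 (Cauchy's inequality); idea card `Cruxes/SystemMomentDeficit/Ideas/small-circle-jensen.md`.
-/

noncomputable section

namespace Summit.Parity.BatemanHorn.Cruxes.SystemMomentDeficit.SmallCircle

open Complex Filter Topology Metric Set Polynomial
open scoped BigOperators

open Literature.NumberTheory.LFunctions.InvZetaRH (exists_log_of_ball)

/-! ### The pinching lemma -/

/-- **Pinching on the vertical line.**  If `F` is holomorphic and zero-free on `‖z − 1‖ < R`,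
`F 1 = 1`, `‖F z‖ ≤ e^M` there (`M ≥ 0`) and `deriv F 1` is real, then
`‖F(1 + iy)‖ ≤ exp(64(M+1)/R² · y²)` for `|y| ≤ R/4`.
[Titchmarsh, Theory of Functions §5.5 (Borel–Carathéodory) + Cauchy's inequality + the mean value
inequality twice along the segment] -/
theorem norm_vertical_le_exp_of_zeroFree (F : ℂ → ℂ) (R M : ℝ) (hR : 0 < R) (hM : 0 ≤ M)
    (hF : DifferentiableOn ℂ F (ball 1 R)) (hF0 : ∀ z ∈ ball (1 : ℂ) R, F z ≠ 0) (hF1 : F 1 = 1)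
    (hbd : ∀ z ∈ ball (1 : ℂ) R, ‖F z‖ ≤ Real.exp M) (him : (deriv F 1).im = 0) :
    ∀ y : ℝ, |y| ≤ R / 4 → ‖F (1 + y * I)‖ ≤ Real.exp (64 * (M + 1) / R ^ 2 * y ^ 2) := by
  intro y hy
  obtain ⟨L, hLd, hL1, hLder, hexp⟩ := exists_log_of_ball hR hF hF0
  rw [hF1, Complex.log_one] at hL1
  have hM1 : 0 < M + 1 := by linarith
  -- `Re L ≤ M + 1` on the disc
  have hre : ∀ z ∈ ball (1 : ℂ) R, (L z).re ≤ M + 1 := by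
    intro z hz
    have h1 : Real.exp (L z).re = ‖F z‖ := by rw [← hexp z hz, norm_exp]
    have h2 : Real.exp (L z).re ≤ Real.exp M := by rw [h1]; exact hbd z hz
    have h3 : (L z).re ≤ M := Real.exp_le_exp.mp h2
    linarith
  -- Borel–Carathéodory: `‖L z‖ ≤ 2(M+1)` for `‖z − 1‖ ≤ R/2`
  have hBC : ∀ z : ℂ, ‖z - 1‖ ≤ R / 2 → ‖L z‖ ≤ 2 * (M + 1) := by
    intro z hz
    set f₀ : ℂ → ℂ := fun w ↦ L (1 + w) with hf₀
    have hshift : ∀ w ∈ ball (0 : ℂ) R, 1 + w ∈ ball (1 : ℂ) R := by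
      intro w hw
      rw [mem_ball_zero_iff] at hw
      rwa [mem_ball, dist_eq_norm, add_sub_cancel_left]
    have hf₀d : DifferentiableOn ℂ f₀ (ball 0 R) := by
      intro w hw
      exact ((hLd.differentiableAt (isOpen_ball.mem_nhds (hshift w hw))).comp w
        ((differentiableAt_const (1 : ℂ)).add differentiableAt_id)).differentiableWithinAt
    have hmaps : MapsTo f₀ (ball 0 R) {w | w.re ≤ M + 1} := fun w hw ↦ hre _ (hshift w hw)
    have hf₀0 : f₀ 0 = 0 := by simp [hf₀, hL1]
    have hw : z - 1 ∈ ball (0 : ℂ) R := by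
      rw [mem_ball_zero_iff]; linarith
    have key := borelCaratheodory_zero hM1 hf₀d hmaps hR hw hf₀0
    have hf₀z : f₀ (z - 1) = L z := by simp [hf₀]
    rw [hf₀z] at key
    refine key.trans ?_
    have hden : 0 < R - ‖z - 1‖ := by linarith
    rw [div_le_iff₀ hden]
    nlinarith [norm_nonneg (z - 1)]
  -- Cauchy's estimate for `L''` at the points `1 + tI`, `|t| ≤ R/4`
  set B : ℝ := 64 * (M + 1) / R ^ 2 with hB
  have hB0 : 0 ≤ B := by rw [hB]; positivity
  have hnormt : ∀ t : ℝ, ‖(1 + (t : ℂ) * I) - 1‖ = |t| := by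
    intro t
    rw [add_sub_cancel_left, norm_mul, Complex.norm_I, mul_one, Complex.norm_real, Real.norm_eq_abs]
  have hmem : ∀ t : ℝ, |t| ≤ R / 4 → (1 + (t : ℂ) * I) ∈ ball (1 : ℂ) R := by
    intro t ht
    rw [mem_ball, dist_eq_norm, hnormt]
    linarith
  have hCauchy : ∀ t : ℝ, |t| ≤ R / 4 → ‖deriv (deriv L) (1 + t * I)‖ ≤ B := by
    intro t ht
    have hR4 : 0 < R / 4 := by linarith
    have hsub : closedBall (1 + (t : ℂ) * I) (R / 4) ⊆ ball (1 : ℂ) R := by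
      intro z hz
      rw [mem_closedBall, dist_eq_norm] at hz
      rw [mem_ball, dist_eq_norm]
      calc ‖z - 1‖ = ‖(z - (1 + (t : ℂ) * I)) + ((1 + (t : ℂ) * I) - 1)‖ := by ring_nf
        _ ≤ ‖z - (1 + (t : ℂ) * I)‖ + ‖(1 + (t : ℂ) * I) - 1‖ := norm_add_le _ _
        _ < R := by rw [hnormt]; linarith
    have hdc : DiffContOnCl ℂ L (ball (1 + (t : ℂ) * I) (R / 4)) := hLd.diffContOnCl_ball hsub
    have hsph : ∀ z ∈ sphere (1 + (t : ℂ) * I) (R / 4), ‖L z‖ ≤ 2 * (M + 1) := by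
      intro z hz
      rw [mem_sphere, dist_eq_norm] at hz
      apply hBC
      calc ‖z - 1‖ = ‖(z - (1 + (t : ℂ) * I)) + ((1 + (t : ℂ) * I) - 1)‖ := by ring_nf
        _ ≤ ‖z - (1 + (t : ℂ) * I)‖ + ‖(1 + (t : ℂ) * I) - 1‖ := norm_add_le _ _
        _ ≤ R / 2 := by rw [hz, hnormt]; linarith
    have hC := norm_iteratedDeriv_le_of_forall_mem_sphere_norm_le 2 hR4 hdc hsph
    rw [iteratedDeriv_succ, iteratedDeriv_one] at hC
    refine hC.trans (le_of_eq ?_)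
    rw [hB, Nat.factorial_two]
    push_cast
    field_simp
    ring
  -- derivatives along the vertical line
  have hg : ∀ t : ℝ, |t| ≤ R / 4 →
      HasDerivAt (fun t : ℝ => (L (1 + (t : ℂ) * I)).re) (deriv L (1 + (t : ℂ) * I) * I).re t := by
    intro t ht
    have hLat : HasDerivAt L (deriv L (1 + (t : ℂ) * I)) (1 + (t : ℂ) * I) :=
      (hLd.differentiableAt (isOpen_ball.mem_nhds (hmem t ht))).hasDerivAt
    have hline : HasDerivAt (fun w : ℂ => 1 + w * I) I (t : ℂ) := by
      simpa using ((hasDerivAt_id (t : ℂ)).mul_const I).const_add 1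
    have hc : HasDerivAt (fun w : ℂ => L (1 + w * I)) (deriv L (1 + (t : ℂ) * I) * I) (t : ℂ) :=
      hLat.comp (t : ℂ) hline
    exact hc.real_of_complex
  have hg₁ : ∀ t : ℝ, |t| ≤ R / 4 →
      HasDerivAt (fun t : ℝ => (deriv L (1 + (t : ℂ) * I) * I).re)
        (deriv (deriv L) (1 + (t : ℂ) * I) * I * I).re t := by
    intro t ht
    have hLat : HasDerivAt (deriv L) (deriv (deriv L) (1 + (t : ℂ) * I)) (1 + (t : ℂ) * I) :=
      ((hLd.deriv isOpen_ball).differentiableAt (isOpen_ball.mem_nhds (hmem t ht))).hasDerivAt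
    have hline : HasDerivAt (fun w : ℂ => 1 + w * I) I (t : ℂ) := by
      simpa using ((hasDerivAt_id (t : ℂ)).mul_const I).const_add 1
    have hc0 : HasDerivAt (fun w : ℂ => deriv L (1 + w * I))
        (deriv (deriv L) (1 + (t : ℂ) * I) * I) (t : ℂ) := by
      have h := HasDerivAt.comp (t : ℂ) (h₂ := deriv L) hLat hline
      simpa [Function.comp_def] using h
    have hc : HasDerivAt (fun w : ℂ => deriv L (1 + w * I) * I)
        (deriv (deriv L) (1 + (t : ℂ) * I) * I * I) (t : ℂ) :=
      hc0.mul_const I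
    exact hc.real_of_complex
  -- values at `0`
  have hg0 : (L (1 + ((0 : ℝ) : ℂ) * I)).re = 0 := by
    simp [hL1]
  have h1mem : (1 : ℂ) ∈ ball (1 : ℂ) R := mem_ball_self hR
  have hL'1 : deriv L 1 = deriv F 1 := by
    rw [(hLder 1 h1mem).deriv, hF1, div_one]
  have hg₁0 : (deriv L (1 + ((0 : ℝ) : ℂ) * I) * I).re = 0 := by
    rw [Complex.ofReal_zero, zero_mul, add_zero, hL'1, Complex.mul_re, Complex.I_re, Complex.I_im,
      him]
    ring
  -- the mean value inequality twice on `uIcc 0 y`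
  have hyR : |y| < R := by linarith
  have hsmem : ∀ t ∈ uIcc (0 : ℝ) y, |t| ≤ R / 4 := by
    intro t ht
    have h := abs_sub_left_of_mem_uIcc ht
    simp only [sub_zero] at h
    exact h.trans hy
  have hstep1 : ∀ t ∈ uIcc (0 : ℝ) y, |(deriv L (1 + (t : ℂ) * I) * I).re| ≤ B * |y| := by
    intro t ht
    have hbound : ∀ u ∈ uIcc (0 : ℝ) y, ‖(deriv (deriv L) (1 + (u : ℂ) * I) * I * I).re‖ ≤ B := by
      intro u hu
      rw [Real.norm_eq_abs]
      calc |(deriv (deriv L) (1 + (u : ℂ) * I) * I * I).re|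
          ≤ ‖deriv (deriv L) (1 + (u : ℂ) * I) * I * I‖ := Complex.abs_re_le_norm _
        _ = ‖deriv (deriv L) (1 + (u : ℂ) * I)‖ := by
            rw [norm_mul, norm_mul, Complex.norm_I, mul_one, mul_one]
        _ ≤ B := hCauchy u (hsmem u hu)
    have key := (convex_uIcc (0 : ℝ) y).norm_image_sub_le_of_norm_hasDerivWithin_le
      (f := fun t : ℝ => (deriv L (1 + (t : ℂ) * I) * I).re)
      (fun u hu => (hg₁ u (hsmem u hu)).hasDerivWithinAt) hbound left_mem_uIcc ht
    rw [hg₁0, sub_zero, sub_zero, Real.norm_eq_abs, Real.norm_eq_abs] at key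
    have ht' : |t| ≤ |y| := by
      have h := abs_sub_left_of_mem_uIcc ht
      simpa only [sub_zero] using h
    calc |(deriv L (1 + (t : ℂ) * I) * I).re| ≤ B * |t| := key
      _ ≤ B * |y| := mul_le_mul_of_nonneg_left ht' hB0
  have hstep2 : (L (1 + (y : ℂ) * I)).re ≤ B * y ^ 2 := by
    have hbound : ∀ u ∈ uIcc (0 : ℝ) y, ‖(deriv L (1 + (u : ℂ) * I) * I).re‖ ≤ B * |y| := by
      intro u hu
      rw [Real.norm_eq_abs]
      exact hstep1 u hu
    have key := (convex_uIcc (0 : ℝ) y).norm_image_sub_le_of_norm_hasDerivWithin_le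
      (f := fun t : ℝ => (L (1 + (t : ℂ) * I)).re)
      (fun u hu => (hg u (hsmem u hu)).hasDerivWithinAt) hbound left_mem_uIcc right_mem_uIcc
    rw [hg0, sub_zero, sub_zero, Real.norm_eq_abs, Real.norm_eq_abs] at key
    have habs : (L (1 + (y : ℂ) * I)).re ≤ |(L (1 + (y : ℂ) * I)).re| := le_abs_self _
    calc (L (1 + (y : ℂ) * I)).re ≤ B * |y| * |y| := habs.trans key
      _ = B * y ^ 2 := by rw [mul_assoc, ← sq, sq_abs]
  -- conclude: ‖F(1+iy)‖ = exp (Re L(1+iy))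
  have hFy : ‖F (1 + (y : ℂ) * I)‖ = Real.exp (L (1 + (y : ℂ) * I)).re := by
    rw [← hexp _ (hmem y hy), norm_exp]
  rw [hFy, Real.exp_le_exp, hB] at *
  exact hstep2

/-! ### Per statistic: the circle mean pinches the vertical line -/

/-- **Per statistic.**  For `S(z) = Σ_{n ≤ x} z^{e n}`, a radius `r > 0`, a real tilt `a` and
`A ≥ 0`: if `⨍_{‖z−1‖=r} log⁺‖S(z)e^{−a(z−1)}/(x+1)‖ ≤ A`, then
`‖S(1+iy)‖ ≤ (x+1)·exp(256(3A+1)e^{2A}/r² · y²)` for `|y| ≤ r e^{−A}/8`. -/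
theorem verticalBound_of_circleAverage (e : ℕ → ℕ) (x : ℕ) (r a A : ℝ) (hr : 0 < r) (hA : 0 ≤ A)
    (hJ : Real.circleAverage (fun z : ℂ => Real.posLog
      ‖(∑ n ∈ Finset.range (x + 1), z ^ (e n)) * Complex.exp (-((a : ℂ) * (z - 1))) /
        ((x : ℂ) + 1)‖) 1 r ≤ A) :
    ∀ y : ℝ, |y| ≤ r * Real.exp (-A) / 8 →
      ‖∑ n ∈ Finset.range (x + 1), (1 + (y : ℂ) * I) ^ (e n)‖ ≤
        ((x : ℝ) + 1) * Real.exp (256 * (3 * A + 1) * Real.exp (2 * A) / r ^ 2 * y ^ 2) := by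
  intro y hy
  set P : ℂ[X] := ∑ n ∈ Finset.range (x + 1), (X : ℂ[X]) ^ (e n) with hP
  have heval : ∀ z : ℂ, P.eval z = ∑ n ∈ Finset.range (x + 1), z ^ (e n) := by
    intro z
    simp [hP, Polynomial.eval_finsetSum]
  have hP1 : P.eval 1 = (x : ℂ) + 1 := by rw [heval]; simp
  have hN : ((x : ℂ) + 1) ≠ 0 := by exact_mod_cast Nat.succ_ne_zero x
  have hP1ne : P.eval 1 ≠ 0 := by rw [hP1]; exact hN
  have hJ' : Real.circleAverage (fun z : ℂ => Real.posLog
      ‖P.eval z * Complex.exp (-((a : ℂ) * (z - 1))) / P.eval 1‖) 1 r ≤ A := by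
    have hfun : (fun z : ℂ => Real.posLog
        ‖P.eval z * Complex.exp (-((a : ℂ) * (z - 1))) / P.eval 1‖) =
        (fun z : ℂ => Real.posLog
          ‖(∑ n ∈ Finset.range (x + 1), z ^ (e n)) * Complex.exp (-((a : ℂ) * (z - 1))) /
            ((x : ℂ) + 1)‖) := by
      funext z
      rw [heval, hP1]
    rw [hfun]
    exact hJ
  -- the tilted normalised polynomial on the disc `‖z − 1‖ < R`, `R = r e^{−A}/2`
  set F : ℂ → ℂ := fun z : ℂ => P.eval z * Complex.exp (-((a : ℂ) * (z - 1))) / P.eval 1 with hF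
  have hzero := stub_zeroFree P r a A hr hA hP1ne hJ'
  have hbound := stub_poissonJensenBound P r a A hr hA hP1ne hJ'
  set R : ℝ := r * Real.exp (-A) / 2 with hR
  have hexp1 : Real.exp (-A) ≤ 1 := by
    rw [Real.exp_le_one_iff]; linarith
  have hexp0 : 0 < Real.exp (-A) := Real.exp_pos _
  have hR0 : 0 < R := by rw [hR]; positivity
  have hRle1 : R ≤ r * Real.exp (-A) := by
    rw [hR]; nlinarith [mul_pos hr hexp0]
  have hRle2 : R ≤ r / 2 := by
    rw [hR]
    have : r * Real.exp (-A) ≤ r * 1 := mul_le_mul_of_nonneg_left hexp1 hr.le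
    linarith
  have hdiff : DifferentiableOn ℂ F (Metric.ball 1 R) := by
    apply Differentiable.differentiableOn
    rw [hF]
    exact ((P.differentiable).mul (by fun_prop)).div_const _
  have hne : ∀ z ∈ Metric.ball (1 : ℂ) R, F z ≠ 0 := by
    intro z hz
    rw [Metric.mem_ball, dist_eq_norm] at hz
    have hPz : P.eval z ≠ 0 := hzero z (lt_of_lt_of_le hz hRle1)
    rw [hF]
    exact div_ne_zero (mul_ne_zero hPz (Complex.exp_ne_zero _)) hP1ne
  have hF1 : F 1 = 1 := by
    rw [hF]
    simp [hP1ne]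
  have hFbd : ∀ z ∈ Metric.ball (1 : ℂ) R, ‖F z‖ ≤ Real.exp (3 * A) := by
    intro z hz
    rw [Metric.mem_ball, dist_eq_norm] at hz
    exact hbound z (le_trans hz.le hRle2)
  have h3A : 0 ≤ 3 * A := by positivity
  -- `F'(1) = P'(1)/P(1) − a = Σe/(x+1) − a` is real
  have him : (deriv F 1).im = 0 := by
    rw [hF, deriv_tilted]
    simp only [sub_self, mul_zero, neg_zero, Complex.exp_zero, mul_one, eval_sub, eval_smul,
      smul_eq_mul]
    rw [hP, Summit.Parity.BatemanHorn.Theorems.eval_one_derivative_sum_X_pow,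
      Summit.Parity.BatemanHorn.Theorems.eval_one_sum_X_pow]
    have hcast : ((∑ n ∈ Finset.range (x + 1), (e n : ℂ)) - (a : ℂ) * ((x : ℂ) + 1)) / ((x : ℂ) + 1) =
        ((((∑ n ∈ Finset.range (x + 1), (e n : ℝ)) - a * ((x : ℝ) + 1)) / ((x : ℝ) + 1) : ℝ) : ℂ) := by
      push_cast
      rfl
    rw [hcast, Complex.ofReal_im]
  have key := norm_vertical_le_exp_of_zeroFree F R (3 * A) hR0 h3A hdiff hne hF1 hFbd him
  -- apply at `y`: `|y| ≤ r e^{-A}/8 = R/4`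
  have hyR : |y| ≤ R / 4 := by
    rw [hR]; linarith
  have hFy := key y hyR
  -- unfold `F(1+iy)`: the tilt has modulus one on the vertical line
  have hFval : ‖F (1 + (y : ℂ) * I)‖ =
      ‖∑ n ∈ Finset.range (x + 1), (1 + (y : ℂ) * I) ^ (e n)‖ / ((x : ℝ) + 1) := by
    rw [hF]
    simp only
    rw [norm_div, norm_mul, heval, hP1, add_sub_cancel_left]
    have htilt : ‖Complex.exp (-((a : ℂ) * ((y : ℂ) * I)))‖ = 1 := by
      rw [Complex.norm_exp]
      simp
    rw [htilt, mul_one]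
    have hNr : ‖(x : ℂ) + 1‖ = (x : ℝ) + 1 := by
      rw [show ((x : ℂ) + 1) = (((x : ℝ) + 1 : ℝ) : ℂ) by push_cast; rfl, Complex.norm_real,
        Real.norm_eq_abs, abs_of_pos (by positivity)]
    rw [hNr]
  rw [hFval, div_le_iff₀ (by positivity)] at hFy
  refine hFy.trans (le_of_eq ?_)
  rw [mul_comm]
  congr 1
  congr 1
  rw [hR, Real.exp_neg]
  have hE : Real.exp A ≠ 0 := (Real.exp_pos A).ne'
  have hE2 : Real.exp (2 * A) = Real.exp A ^ 2 := by
    rw [← Real.exp_nat_mul]; norm_num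
  rw [hE2]
  field_simp
  ring

/-! ### K1-shape ⇒ VSG-shape, and the edges through K1 -/

/-- **`SmallCircleJensen → VerticalSubGaussian`** (registered sub-goal of the line `Sketch`): the
old registered stub K1 implies the reshaped one VSG, for every Bateman–Horn system (constants
`C = 256(3A+1)e^{2A}/r²`, `y₀ = r e^{−A}/8`). -/
theorem verticalSubGaussian_of_smallCircle : (∀ (k : ℕ) (f : Fin k → Polynomial ℤ), Literature.NumberTheory.Sieve.IsBatemanHornSystem f → ∃ r A : ℝ, ∃ x₀ : ℕ, 0 < r ∧ 0 ≤ A ∧ ∀ x : ℕ, x₀ ≤ x → ∃ a : ℝ, Real.circleAverage (fun z : ℂ => Real.posLog ‖(∑ n ∈ Finset.range (x + 1), z ^ (∑ i, (((f i).eval (n : ℤ)).toNat.factorization.sum fun _ v => min v 2))) * Complex.exp (-((a : ℂ) * (z - 1))) / ((x : ℂ) + 1)‖) 1 r ≤ A) → ∀ (k : ℕ) (f : Fin k → Polynomial ℤ), Literature.NumberTheory.Sieve.IsBatemanHornSystem f → ∃ C y₀ : ℝ, ∃ x₀ : ℕ, 0 < y₀ ∧ ∀ x : ℕ, x₀ ≤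 x → ∀ y : ℝ, 0 < y → y ≤ y₀ → ‖∑ n ∈ Finset.range (x + 1), (1 + (y : ℂ) * Complex.I) ^ (∑ i, (((f i).eval (n : ℤ)).toNat.factorization.sum fun _ v => min v 2))‖ ≤ ((x : ℝ) + 1) * Real.exp (C * y ^ 2) := by
  intro hK1 k f hf
  obtain ⟨r, A, x₀, hr, hA, hJ⟩ := hK1 k f hf
  refine ⟨256 * (3 * A + 1) * Real.exp (2 * A) / r ^ 2, r * Real.exp (-A) / 8, x₀,
    by positivity, ?_⟩
  intro x hx y hy hyy
  obtain ⟨a, ha⟩ := hJ x hx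
  have hy' : |y| ≤ r * Real.exp (-A) / 8 := by rwa [abs_of_pos hy]
  exact verticalBound_of_circleAverage
    (fun n => ∑ i, (((f i).eval (n : ℤ)).toNat.factorization.sum fun _ v => min v 2))
    x r a A hr hA ha y hy'

/-- **Rank 8 ⇒ VSG**: `DiscMajorantLog → VerticalSubGaussian` (through K1, p140287). -/
theorem verticalSubGaussian_of_discMajorantLog :
    Summit.Parity.BatemanHorn.Theses.AlmostPrimeZeros.DiscMajorantLog →
    ∀ (k : ℕ) (f : Fin k → Polynomial ℤ), Literature.NumberTheory.Sieve.IsBatemanHornSystem f →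
      ∃ C y₀ : ℝ, ∃ x₀ : ℕ, 0 < y₀ ∧ ∀ x : ℕ, x₀ ≤ x → ∀ y : ℝ, 0 < y → y ≤ y₀ →
        ‖∑ n ∈ Finset.range (x + 1), (1 + (y : ℂ) * Complex.I) ^
            (∑ i, (((f i).eval (n : ℤ)).toNat.factorization.sum fun _ v => min v 2))‖ ≤
          ((x : ℝ) + 1) * Real.exp (C * y ^ 2) :=
  fun hD => verticalSubGaussian_of_smallCircle (stub_smallCircle_of_discMajorantLog hD)

/-- **Rank 2 ⇒ VSG**: `SystemZeroRepulsion → VerticalSubGaussian` (through K1, p140991). -/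
theorem verticalSubGaussian_of_systemZeroRepulsion :
    Summit.Parity.BatemanHorn.Theses.AlmostPrimeZeros.SystemZeroRepulsion →
    ∀ (k : ℕ) (f : Fin k → Polynomial ℤ), Literature.NumberTheory.Sieve.IsBatemanHornSystem f →
      ∃ C y₀ : ℝ, ∃ x₀ : ℕ, 0 < y₀ ∧ ∀ x : ℕ, x₀ ≤ x → ∀ y : ℝ, 0 < y → y ≤ y₀ →
        ‖∑ n ∈ Finset.range (x + 1), (1 + (y : ℂ) * Complex.I) ^
            (∑ i, (((f i).eval (n : ℤ)).toNat.factorization.sum fun _ v => min v 2))‖ ≤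
          ((x : ℝ) + 1) * Real.exp (C * y ^ 2) :=
  fun hR => verticalSubGaussian_of_smallCircle (smallCircle_of_systemZeroRepulsion hR)

/-- **Calibration: VSG holds for the system `(X)`** (through K1 at `(X)`, p140780, i.e. the tree's
tilted Selberg–Delange majorant for the capped statistic of `n`). -/
theorem verticalSubGaussian_X :
    ∃ C y₀ : ℝ, ∃ x₀ : ℕ, 0 < y₀ ∧ ∀ x : ℕ, x₀ ≤ x → ∀ y : ℝ, 0 < y → y ≤ y₀ →
      ‖∑ n ∈ Finset.range (x + 1), (1 + (y : ℂ) * Complex.I) ^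
          (∑ i : Fin 1, (((![(Polynomial.X : Polynomial ℤ)] i).eval (n : ℤ)).toNat.factorization.sum
            fun _ v => min v 2))‖ ≤
        ((x : ℝ) + 1) * Real.exp (C * y ^ 2) := by
  obtain ⟨r, A, x₀, hr, hA, hJ⟩ := smallCircleJensen_X
  refine ⟨256 * (3 * A + 1) * Real.exp (2 * A) / r ^ 2, r * Real.exp (-A) / 8, x₀,
    by positivity, ?_⟩
  intro x hx y hy hyy
  obtain ⟨a, ha⟩ := hJ x hx
  have hy' : |y| ≤ r * Real.exp (-A) / 8 := by rwa [abs_of_pos hy]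
  exact verticalBound_of_circleAverage
    (fun n => ∑ i : Fin 1, (((![(Polynomial.X : Polynomial ℤ)] i).eval (n : ℤ)).toNat.factorization.sum
      fun _ v => min v 2)) x r a A hr hA ha y hy'

end Summit.Parity.BatemanHorn.Cruxes.SystemMomentDeficit.SmallCircle

end
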